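import Mathlib.Topology.LocallyConstant.Basic
import Literature.NumberTheory.Automorphic.SmoothInduction
import HarnessLib

/-!
# Compact support of the open-cell function of an induced vector vanishing on the closed cell (Iwasawa + Bruhat)

Topic `NumberTheory/Automorphic`; namespace `Literature.NumberTheory.Automorphic`.  THEOREMS ONLY: no definition, no
named fact, no `sorry`, no instance, no notation.  Registry pub/hodgecm-mathlib F0∕P3, T3b statement tree, node N1
(`U3PrincipalSeriesJacquetFiltration`, [Casselman1995, §6.3 and Lemma 7.1.1 (a)]) — the UPPER-BOUND half «the open Bruhat
cell contributes AT MOST `dim W` to the Jacquet module» needs the cell function of a section vanishing on the closed cell to be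
COMPACTLY SUPPORTED; this file is the generic (group-theoretic) form of that input, kept separate from the `U(3)` instance.

## The mathematics ([BernsteinZelevinsky1977, §5, proof of Thm. 5.2 (the open orbit)]; [Casselman1995, Prop. 6.3.1–6.3.3])

`H ≤ G` topological groups, `σ` a representation of `H` on `W`, `Ind_H^G σ` the smooth induction (★ `Representation.SmoothInd`:
LEFT `H`-equivariant functions `f (h g) = σ(h) f(g)` with open stabiliser under RIGHT translation), `w₀ ∈ G`, `ι : Γ →* G`
(in the application `Γ = N`, `H = P`, `w₀` a Weyl representative, `H w₀ ι(Γ)` the open cell).  The **cell function** of `f` is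
`γ ↦ f (w₀ ι(γ))` (★ `SmoothIndOpenCellHaarFunctional` §2).  HYPOTHESES (abstract Iwasawa + Bruhat):

* (Iw) `G = H · K₀` for a COMPACT set `K₀ ⊆ G`;
* (Br) every compact subset of `G` avoiding `H` lies in `H · w₀ · ι(D)` for a compact `D ⊆ Γ` («compact subsets of the open
  cell are compact in the `N`-direction» — for `GL_n` this is ★ `exists_isCompact_subset_parabolic_mul_permGL_mul`; it follows
  from a big-cell coordinate `nc : G → Γ`, `nc (h w₀ ι γ) = γ`, continuous off `H`, together with `G = H ⊔ H w₀ ι(Γ)` — see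
  `SmoothInd.hasCompactSupport_cellFun_of_continuousOn_coord`);
* (Un) `h w₀ ι(γ) = w₀ ι(γ') ⟹ γ = γ'` (uniqueness of the `N`-coordinate; automatic in the coordinate form).

CLAIM: if `f ∈ Ind_H^G σ` vanishes at `1` (equivalently on `H`: `f(h) = σ(h) f(1)`), its cell function has compact support.
PROOF (no Haar measure, no valuations, no transversals): `f` is right-invariant under its open stabiliser, hence locally constant,
so `Z = {g | f g ≠ 0}` is closed and `C = K₀ ∩ Z` is compact; `C` avoids `H` because `f|_H = σ(·) f(1) = 0`; by (Br) `C ⊆ H w₀ ι(D)`.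
If `f (w₀ ι γ) ≠ 0`, write `w₀ ι γ = h κ` by (Iw); then `f κ = σ(h)⁻¹ f(w₀ ι γ) ≠ 0`, so `κ ∈ C`, `κ = h' w₀ ι d` with `d ∈ D`, and
`w₀ ι γ = (h h') w₀ ι d` forces `γ = d ∈ D` by (Un).  So the support lies in the compact `D`.
HC_CM is proved only modulo the printed citations until rung 0 closes; this file discharges no named fact.

## References
* [BernsteinZelevinsky1977] I. N. Bernstein, A. V. Zelevinsky, *Induced representations of reductive `p`-adic groups. I*,
  Ann. Sci. ÉNS (4) 10 (1977), §5 (proof of Thm. 5.2: the open `Q`-orbit on `P \ G`), §5.14.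
* [Casselman1995] W. Casselman, *Introduction to the theory of admissible representations of `p`-adic reductive groups*
  (draft 1 May 1995), Prop. 1.3.1, Prop. 6.3.1–6.3.3, Lemma 7.1.1 (a).
* [BruhatTits1972] F. Bruhat, J. Tits, *Groupes réductifs sur un corps local I*, Publ. Math. IHÉS 41 (1972), (4.4.3) (Iwasawa
  decomposition `G = P · K₀`).
-/

set_option autoImplicit false

open scoped Pointwise
open Topology

namespace Literature.NumberTheory.Automorphic

section Coord

variable {G : Type*} [Group G] {H : Subgroup G} {Γ : Type*} [Group Γ] (ι : Γ →* G) (w₀ : G)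

/-- **(Br) and (Un) from a continuous big-cell coordinate**: if `G = H ⊔ H w₀ ι(Γ)` (two cells) and `nc : G → Γ` recovers the
`Γ`-coordinate on the open cell (`nc (h w₀ ι γ) = γ`) and is continuous off `H`, then compact subsets of `G` avoiding `H` have
coordinates in the compact image `nc '' C`, and the coordinate is unique. (For `GL_n` the coordinate is the big-cell normal form
★ `openCellN`; for `U(Φ₃)` at a non-split place it is the same coordinate restricted, ★ `U3LocalBruhatDecompositionProofs`.)
[cite: Casselman1995, Prop. 1.3.3] [cite: BernsteinZelevinsky1977, §5.14] -/
theorem exists_isCompact_coord_of_continuousOn [TopologicalSpace G] [TopologicalSpace Γ]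
    (hcell : ∀ g : G, g ∉ H → ∃ h ∈ H, ∃ γ : Γ, g = h * w₀ * ι γ)
    (nc : G → Γ) (hnc : ∀ h ∈ H, ∀ γ : Γ, nc (h * w₀ * ι γ) = γ) (hncc : ContinuousOn nc {g : G | g ∉ H})
    (C : Set G) (hC : IsCompact C) (hCH : ∀ g ∈ C, g ∉ H) :
    ∃ D : Set Γ, IsCompact D ∧ ∀ g ∈ C, ∃ h ∈ H, ∃ γ ∈ D, g = h * w₀ * ι γ := by
  refine ⟨nc '' C, hC.image_of_continuousOn (hncc.mono fun g hg => hCH g hg), fun g hg => ?_⟩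
  obtain ⟨h, hh, γ, hgγ⟩ := hcell g (hCH g hg)
  refine ⟨h, hh, γ, ⟨g, hg, ?_⟩, hgγ⟩
  rw [hgγ, hnc h hh γ]

/-- uniqueness of the coordinate from `nc`: `h w₀ ι(γ) = w₀ ι(γ') ⟹ γ = γ'`. [cite: Casselman1995, Prop. 1.3.3] -/
theorem coord_unique_of_coord (nc : G → Γ) (hnc : ∀ h ∈ H, ∀ γ : Γ, nc (h * w₀ * ι γ) = γ)
    (h : G) (hh : h ∈ H) (γ γ' : Γ) (heq : h * w₀ * ι γ = w₀ * ι γ') : γ = γ' := by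
  have h1 := hnc h hh γ
  rw [heq, ← one_mul (w₀ * ι γ'), ← mul_assoc, hnc 1 H.one_mem γ'] at h1
  exact h1.symm

end Coord

section Support

variable {k : Type*} [CommRing k] {G : Type*} [Group G] [TopologicalSpace G] [IsTopologicalGroup G] {H : Subgroup G}
  {W : Type*} [AddCommGroup W] [Module k W] {σ : Representation k H W}
  {Γ : Type*} [Group Γ] (ι : Γ →* G) (w₀ : G)

/-- **a smooth induced vector is a locally constant function on `G`**: `f ∈ Ind_H^G σ` is fixed under right translation by its
open stabiliser `K_f`, hence constant on every coset `g K_f`. [cite: BernsteinZelevinsky1977, §2.3] -/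
theorem SmoothInd.isLocallyConstant_toFun (f : Representation.SmoothInd H σ) : IsLocallyConstant f.toFun := by
  rw [IsLocallyConstant.iff_exists_open]
  intro g
  have hopen : IsOpen ((Representation.smoothIndRep H σ).stabilizerSubgroup f : Set G) :=
    Representation.isSmooth_smoothInd H σ f
  refine ⟨(fun g' => g * g') '' ((Representation.smoothIndRep H σ).stabilizerSubgroup f : Set G),
    (Homeomorph.mulLeft g).isOpenMap _ hopen, ⟨1, Subgroup.one_mem _, mul_one g⟩, ?_⟩
  rintro _ ⟨κ, hκ, rfl⟩
  have hfix : Representation.smoothIndRep H σ κ f = f := by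
    simpa only [SetLike.mem_coe, Representation.mem_stabilizerSubgroup] using hκ
  have h := congrArg (fun f' : Representation.SmoothInd H σ => f'.toFun g) hfix
  simp only [Representation.toFun_smoothIndRep_apply] at h
  exact h

/-- the non-vanishing set `{g | f g ≠ 0}` of a smooth induced vector is closed (`f` is locally constant, so its zero fibre is
open). [cite: BernsteinZelevinsky1977, §2.3] -/
theorem SmoothInd.isClosed_setOf_toFun_ne_zero (f : Representation.SmoothInd H σ) :
    IsClosed {g : G | f.toFun g ≠ 0} := by
  have h : {g : G | f.toFun g ≠ 0} = {g : G | f.toFun g = 0}ᶜ := by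
    ext g
    simp only [ne_eq, Set.mem_setOf_eq, Set.mem_compl_iff]
  rw [h]
  exact ((SmoothInd.isLocallyConstant_toFun f).isOpen_fiber 0).isClosed_compl

/-- a smooth induced vector vanishing at `1` vanishes on the inducing subgroup: `f(h) = σ(h) f(1) = 0`.
[cite: BernsteinZelevinsky1977, §2.3] -/
theorem SmoothInd.toFun_eq_zero_of_mem (f : Representation.SmoothInd H σ) (hf : f.toFun 1 = 0) {h : G} (hh : h ∈ H) :
    f.toFun h = 0 := by
  have h1 := f.toFun_subgroup_mul ⟨h, hh⟩ 1
  rw [mul_one] at h1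
  rw [h1, hf, map_zero]

/-- **THE SUPPORT OF THE CELL FUNCTION IS CONTAINED IN A COMPACT SET** ([BernsteinZelevinsky1977, §5, the open orbit in the
proof of Thm. 5.2]; [Casselman1995, Prop. 6.3.1–6.3.3]): under (Iw) `G = H · K₀` with `K₀` compact, (Br) «compact subsets of
`G` avoiding `H` lie in `H · w₀ · ι(D)` with `D ⊆ Γ` compact» and (Un) «`h w₀ ι(γ) = w₀ ι(γ') ⟹ γ = γ'`», the cell function
`γ ↦ f (w₀ ι(γ))` of an `f ∈ Ind_H^G σ` with `f(1) = 0` is supported in a compact subset of `Γ` (`C := K₀ ∩ {f ≠ 0}` is compact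
and avoids `H`; if `f (w₀ ι γ) ≠ 0` and `w₀ ι γ = h κ` then `κ ∈ C ⊆ H w₀ ι(D)` and `γ ∈ D` by (Un)).
[cite: BernsteinZelevinsky1977, §5 (proof of Thm. 5.2)] [cite: Casselman1995, Prop. 6.3.1] -/
theorem SmoothInd.exists_isCompact_forall_cellFun_ne_zero_mem [TopologicalSpace Γ] {K₀ : Set G} (hK₀ : IsCompact K₀)
    (hIw : ∀ g : G, ∃ h ∈ H, ∃ κ ∈ K₀, g = h * κ)
    (hBr : ∀ C : Set G, IsCompact C → (∀ g ∈ C, g ∉ H) →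
      ∃ D : Set Γ, IsCompact D ∧ ∀ g ∈ C, ∃ h ∈ H, ∃ γ ∈ D, g = h * w₀ * ι γ)
    (hUn : ∀ h ∈ H, ∀ γ γ' : Γ, h * w₀ * ι γ = w₀ * ι γ' → γ = γ')
    (f : Representation.SmoothInd H σ) (hf : f.toFun 1 = 0) :
    ∃ D : Set Γ, IsCompact D ∧ ∀ γ : Γ, f.toFun (w₀ * ι γ) ≠ 0 → γ ∈ D := by
  -- the compact `C = K₀ ∩ {f ≠ 0}` avoids `H`
  have hC : IsCompact (K₀ ∩ {g : G | f.toFun g ≠ 0}) := hK₀.inter_right (SmoothInd.isClosed_setOf_toFun_ne_zero f)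
  have hCH : ∀ g ∈ K₀ ∩ {g : G | f.toFun g ≠ 0}, g ∉ H := fun g hg hgH => hg.2 (SmoothInd.toFun_eq_zero_of_mem f hf hgH)
  obtain ⟨D, hD, hCD⟩ := hBr _ hC hCH
  refine ⟨D, hD, fun γ hγ => ?_⟩
  -- Iwasawa: `w₀ ι γ = h κ`, and `f κ ≠ 0`
  obtain ⟨h, hh, κ, hκ, hwκ⟩ := hIw (w₀ * ι γ)
  have hfκ : f.toFun κ ≠ 0 := by
    intro h0
    apply hγ
    have h1 := f.toFun_subgroup_mul ⟨h, hh⟩ κ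
    rw [Subgroup.coe_mk] at h1
    rw [hwκ, h1, h0, map_zero]
  -- so `κ ∈ C ⊆ H w₀ ι(D)` and `γ` is the `D`-coordinate
  obtain ⟨h', hh', d, hd, hκd⟩ := hCD κ ⟨hκ, hfκ⟩
  have heq : h * h' * w₀ * ι d = w₀ * ι γ := by
    rw [hwκ, hκd]
    simp only [mul_assoc]
  have hdγ : d = γ := hUn (h * h') (H.mul_mem hh hh') d γ heq
  exact hdγ ▸ hd

/-- **COMPACT SUPPORT OF THE CELL FUNCTION OF A SECTION VANISHING ON THE CLOSED CELL** (abstract Iwasawa + Bruhat form;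
[BernsteinZelevinsky1977, §5]; [Casselman1995, §6.3]): under (Iw), (Br), (Un) as in
`SmoothInd.exists_isCompact_forall_cellFun_ne_zero_mem`, for every `f ∈ Ind_H^G σ` with `f(1) = 0` the cell function
`γ ↦ f (w₀ ι(γ))` has compact support (its support lies in the compact `D`; the closure of a compact subset of a topological group
is compact). This is the `hf : HasCompactSupport …` input of ★ `SmoothInd.integrable_cellFun` ∕ the open-cell transfer into
`C_c^∞(N, W)`. [cite: BernsteinZelevinsky1977, §5 (proof of Thm. 5.2)] [cite: Casselman1995, Prop. 6.3.1] -/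
theorem SmoothInd.hasCompactSupport_cellFun_of_toFun_one_eq_zero [TopologicalSpace Γ] [IsTopologicalGroup Γ] {K₀ : Set G} (hK₀ : IsCompact K₀)
    (hIw : ∀ g : G, ∃ h ∈ H, ∃ κ ∈ K₀, g = h * κ)
    (hBr : ∀ C : Set G, IsCompact C → (∀ g ∈ C, g ∉ H) →
      ∃ D : Set Γ, IsCompact D ∧ ∀ g ∈ C, ∃ h ∈ H, ∃ γ ∈ D, g = h * w₀ * ι γ)
    (hUn : ∀ h ∈ H, ∀ γ γ' : Γ, h * w₀ * ι γ = w₀ * ι γ' → γ = γ')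
    (f : Representation.SmoothInd H σ) (hf : f.toFun 1 = 0) :
    HasCompactSupport fun γ => f.toFun (w₀ * ι γ) := by
  obtain ⟨D, hD, hsupp⟩ := SmoothInd.exists_isCompact_forall_cellFun_ne_zero_mem ι w₀ hK₀ hIw hBr hUn f hf
  refine IsCompact.of_isClosed_subset hD.closure (isClosed_tsupport _) ?_
  exact closure_mono fun γ hγ => hsupp γ hγ

/-- **COMPACT SUPPORT OF THE CELL FUNCTION — coordinate form**: `G = H · K₀` (`K₀` compact), `G = H ⊔ H w₀ ι(Γ)`, and a big-cell
coordinate `nc` with `nc (h w₀ ι γ) = γ`, continuous off `H`; then the cell function of every `f ∈ Ind_H^G σ` with `f(1) = 0` is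
compactly supported. [cite: BernsteinZelevinsky1977, §5 (proof of Thm. 5.2)] [cite: Casselman1995, Prop. 6.3.1] -/
theorem SmoothInd.hasCompactSupport_cellFun_of_continuousOn_coord [TopologicalSpace Γ] [IsTopologicalGroup Γ] {K₀ : Set G} (hK₀ : IsCompact K₀)
    (hIw : ∀ g : G, ∃ h ∈ H, ∃ κ ∈ K₀, g = h * κ)
    (hcell : ∀ g : G, g ∉ H → ∃ h ∈ H, ∃ γ : Γ, g = h * w₀ * ι γ)
    (nc : G → Γ) (hnc : ∀ h ∈ H, ∀ γ : Γ, nc (h * w₀ * ι γ) = γ) (hncc : ContinuousOn nc {g : G | g ∉ H})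
    (f : Representation.SmoothInd H σ) (hf : f.toFun 1 = 0) :
    HasCompactSupport fun γ => f.toFun (w₀ * ι γ) :=
  SmoothInd.hasCompactSupport_cellFun_of_toFun_one_eq_zero ι w₀ hK₀ hIw
    (exists_isCompact_coord_of_continuousOn ι w₀ hcell nc hnc hncc) (coord_unique_of_coord ι w₀ nc hnc) f hf

/-- **support criterion, coordinate form**: the cell function of `f` (`f(1) = 0`) vanishes at `γ` unless `γ = nc κ` for some
`κ ∈ K₀` off `H` with `f κ ≠ 0` — i.e. its support lies in `nc '' (K₀ ∩ {f ≠ 0})`. [cite: BernsteinZelevinsky1977, §5 (proof of Thm. 5.2)] -/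
theorem SmoothInd.cellFun_support_subset_image_coord {K₀ : Set G}
    (hIw : ∀ g : G, ∃ h ∈ H, ∃ κ ∈ K₀, g = h * κ)
    (hcell : ∀ g : G, g ∉ H → ∃ h ∈ H, ∃ γ : Γ, g = h * w₀ * ι γ)
    (nc : G → Γ) (hnc : ∀ h ∈ H, ∀ γ : Γ, nc (h * w₀ * ι γ) = γ)
    (f : Representation.SmoothInd H σ) (hf : f.toFun 1 = 0) :
    (Function.support fun γ => f.toFun (w₀ * ι γ)) ⊆ nc '' (K₀ ∩ {g : G | g ∉ H ∧ f.toFun g ≠ 0}) := by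
  intro γ hγ
  rw [Function.mem_support] at hγ
  obtain ⟨h, hh, κ, hκ, hwκ⟩ := hIw (w₀ * ι γ)
  have hfκ : f.toFun κ ≠ 0 := by
    intro h0
    apply hγ
    have h1 := f.toFun_subgroup_mul ⟨h, hh⟩ κ
    rw [Subgroup.coe_mk] at h1
    rw [hwκ, h1, h0, map_zero]
  have hκH : κ ∉ H := fun hκH => hfκ (SmoothInd.toFun_eq_zero_of_mem f hf hκH)
  obtain ⟨h', hh', d, hκd⟩ := hcell κ hκH
  refine ⟨κ, ⟨hκ, hκH, hfκ⟩, ?_⟩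
  have heq : h * h' * w₀ * ι d = w₀ * ι γ := by
    rw [hwκ, hκd]
    simp only [mul_assoc]
  rw [hκd, hnc h' hh' d]
  exact coord_unique_of_coord ι w₀ nc hnc (h * h') (H.mul_mem hh hh') d γ heq

end Support

end Literature.NumberTheory.Automorphic
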